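import Literature.AlgebraicGeometry.HodgeTheory.ComplexTorusIntegralHodgeClassesRelativePontryaginProduct
import Literature.AlgebraicGeometry.HodgeTheory.ComplexTorusIntegralHodgeClassesCorrespondenceFunctoriality
import Literature.AlgebraicGeometry.HodgeTheory.ComplexTorusIntegralHodgeClassesPontryaginProduct
import Literature.AlgebraicGeometry.HodgeTheory.ComplexTorusIntegralHodgeClassesMultiplicationCorrespondences
import HarnessLib

/-!
# Pontryagin correspondences `Π_c = (s_X)_*(p₂^*c) = [Δ_X] ⋆_X (X × c)`: the correspondence INDUCING THE PONTRYAGIN PRODUCT `x ↦ x ⋆ c`, and `Π_c ∘ α = α ⋆_W (W × c)`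

The `⋆`-side companion of g33-#3 `ComplexTorusIntegralHodgeClassesMultiplicationCorrespondences` (`Δ_*(u)` induces the intersection product `u · (−)`; `Δ_*(v) ∘ α =
α · p₂^*v`). In Künnemann's Lefschetz 𝔰𝔩₂-triple for an abelian scheme, the Lefschetz operator is the multiplication correspondence `L_γ = Δ_*(ℓ(γ))` and the
operator `Λ` "is the `∗`-product with the class `λ(β)`" [cite: Moonen2011ChowMotiveAbelianSchemes, §5 (arXiv p0014 L47–L78: "`L_γ = Δ_*(ℓ(γ)) ∈ CH^{g+1}(X ×_S X)` … on
Chow groups, `Λ_β` is the `∗`-product with the class `λ(β)`")]; the commutator `[Λ, L]` is then computed from "`pr₂^*(λ) ⋆_{pr₁} ([Γ_id] · pr₂^*(ℓ)) − pr₂^*(ℓ) · ([Γ_id]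
⋆_{pr₁} pr₂^*(λ))`" [cite: Moonen2011ChowMotiveAbelianSchemes, §5 proof (arXiv p0017 L37–L40), after Künnemann, Invent. Math. 113 (1993), Lemmas 1.1 (1), 3.1 (1)]. This
file supplies, on the integral carriers `Hdg•(−, ℤ)` of complex tori and with the RELATIVE PONTRYAGIN PRODUCT `α ⋆_W β = (1_W × μ_X)_*(p₁₂^*α · p₁₃^*β)` of this
seat's g31-#5 `…RelativePontryaginProduct` (Lange §6.3.4) and the absolute product `x ⋆ y = μ_*(x ⊠ y)` of g31-#4 `…PontryaginProduct` (Lange §6.2.3):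

* §0 plumbing for the SHEAR `s_X = (pr₁, pr₁ + pr₂) : X × X ⥲ X × X` and `1_W × s_X` (`s ≫ pr₁ = pr₁`, `s ≫ pr₂ = μ`, `(1 × s) ≫ p₁₂ = p₁₂`, `(1 × s) ≫ p₁₃ = 1 × μ`);
* §1 THE PONTRYAGIN CORRESPONDENCE OF `c ∈ Hdgᵈ(X, ℤ)`, `Π_c := (s_X)_*(p₂^*c) ∈ Hdgᵈ(X × X, ℤ)` (the class of `{(x, x + y)}` weighted by `c(y)`), and
  **`[Δ_X] ⋆_X (X × c) = Π_c = (X × c) ⋆_X [Δ_X]`** — the shear formula `[Γ_f] ⋆_X β = (s_f)_*β` of g31-#5 at `f = 1_X` (Künnemann–Moonen's "`[Γ_id] ⋆_{pr₁} pr₂^*(λ)`")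
  [cite: Lange2023AbelianVarietiesComplex, §6.3.4 (p0319 L28–L41) and Lemma 6.3.13 (proof, p0320 L13–L17)];
* §2 **`(Π_c)_*(x) = x ⋆ c` for every `x ∈ Hdgᵖ(X, ℤ)`** (`α_*(x) = p_{2*}(α · p₁^*x)`, Fulton Def. 16.1.2): the correspondence `Π_c` INDUCES THE PONTRYAGIN PRODUCT WITH `c`
  — projection formula for `s`, `s ≫ pr₂ = μ`, `s ≫ pr₁ = pr₁` [cite: Lange2023AbelianVarietiesComplex, §6.2.3 (p0308 L3–L7)] [cite: Fulton1998, §16.1 Def. 16.1.2 (p0295 L9–L13) and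
  Prop. 8.3 (c) (p0132 L46–L48)] [cite: Beauville1983FourierChow, §2 (p. 243: "`x ∗ y = m_*(r^*x · s^*y)`")];
* §3 **`Π_c ∘ α = α ⋆_W (W × c)` for EVERY correspondence `α ∈ Hdgᵃ(W × X, ℤ)`** (composite `p₁₃_*(p₁₂^*α · p₂₃^*Π_c)` on `W × (X × X)`): post-composing with the Pontryagin
  correspondence is the relative Pontryagin product, over the source `W`, with the constant family `W × c = p₂^*c` — the `⋆`-analogue of `Δ_*(v) ∘ α = α · p₂^*v`
  (g33-#3 §3) and the relation behind Künnemann's computation of `[Λ, L]`: flat base change `p₂₃^*(s_*z) = (1_W × s)_*(p₂₃^*z)` (g27-#8), the projection formula for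
  `1_W × s` (g27-#2), and §0 [cite: Moonen2011ChowMotiveAbelianSchemes, §5 proof (arXiv p0017 L37–L40)] [cite: Fulton1998, §16.1 Prop. 16.1.1 (c)(i) with proof (p0293 L24; p0294 L21–L28)]
  [cite: Lange2023AbelianVarietiesComplex, §6.2.1 Thm. 6.2.4, Thm. 6.2.5 (p0302)];
* §4 **`(W × c′) ⋆_W (W × c) = W × (c′ ⋆ c)`**: on constant families the relative product is the absolute Pontryagin product (`p₁₂ ≫ p₂ = p₂₃ ≫ pr₁`, `p₁₃ ≫ p₂ = p₂₃ ≫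
  pr₂`, base change `(1_W × μ)_*(p₂₃^*z) = p₂^*(μ_*z)`), so that `Π_c ∘ Π_{c′} ∘ α = α ⋆_W (W × (c′ ⋆ c))` [cite: Lange2023AbelianVarietiesComplex, §6.3.4 (p0319 L36–L41: "As in the
  absolute case …") and §6.2.3 (p0308 L3–L7)].

Everything is a theorem (no definition, no named fact, D-0026); frames are arbitrary and explicit as in g27–g33.

## References

* [Lange2023AbelianVarietiesComplex] H. Lange, Abelian Varieties over the Complex Numbers, Springer 2023 — §6.3.4 (relative Pontryagin product, Lemma 6.3.13), §6.2.3, §6.2.1.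
* [Moonen2011ChowMotiveAbelianSchemes] B. Moonen, On the Chow motive of an abelian scheme with non-trivial endomorphisms, J. reine angew. Math. 711 (2016), arXiv:1110.4264 — §5
  (Lefschetz and Lambda operators after Künnemann).
* [Fulton1998] W. Fulton, Intersection Theory, 2nd ed., Springer 1998 — §16.1 Def. 16.1.2, Prop. 16.1.1 (c); Prop. 8.3 (c).
* [Beauville1983FourierChow] A. Beauville, Quelques remarques sur la transformation de Fourier dans l'anneau de Chow d'une variété abélienne, LNM 1016 (1983) — §2.
-/

noncomputable section

open CategoryTheory Function

namespace Literature.AlgebraicGeometry.HodgeTheory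

open Literature.AlgebraicGeometry.Motives Literature.AlgebraicGeometry.Motives.HodgeStructure
open Literature.Geometry.Kaehler Literature.Geometry.Kaehler.ComplexTorus

namespace ComplexTorusCat

/-! ## §0 Plumbing for the shear `s_X = (pr₁, pr₁ + pr₂)` and `1_W × s_X` -/

section Plumbing

variable (W X : ComplexTorusCat)

/-- `s_X ≫ pr₂ = μ_X` for the shear `s_X = (pr₁, pr₁ + pr₂)` (`μ = pr₁ + pr₂`, g17-#1). [cite: Lange2023AbelianVarietiesComplex, §2.5.3 (p0133 L20) and §6.3.4 (p0319 L30–L32)] -/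
theorem liftHom_fst_add_comp_sndHom : liftHom (fstHom X X) (fstHom X X + sndHom X X) ≫ sndHom X X = addHom X := by
  rw [liftHom_sndHom, ← addHom_def]

/-- `(1_W × s_X) ≫ p₁₂ = p₁₂` on `W × (X × X)` (`s_X ≫ pr₁ = pr₁`). [cite: Lange2023AbelianVarietiesComplex, §6.3.4 (p0319 L28–L36)] -/
theorem prodMap_id_liftHom_fst_add_comp_proj₁₂ :
    prodMap (𝟙 W) (liftHom (fstHom X X) (fstHom X X + sndHom X X)) ≫ liftHom (fstHom W (prodObj X X)) (sndHom W (prodObj X X) ≫ fstHom X X) =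
      liftHom (fstHom W (prodObj X X)) (sndHom W (prodObj X X) ≫ fstHom X X) := by
  refine prod_hom_ext ?_ ?_ <;> simp

/-- `(1_W × s_X) ≫ p₁₃ = 1_W × μ_X` on `W × (X × X)` (`s_X ≫ pr₂ = μ`): the shear followed by `p₁₃` is the relative addition. [cite: Lange2023AbelianVarietiesComplex, §6.3.4 (p0319 L30–L36)] -/
theorem prodMap_id_liftHom_fst_add_comp_proj₁₃ :
    prodMap (𝟙 W) (liftHom (fstHom X X) (fstHom X X + sndHom X X)) ≫ liftHom (fstHom W (prodObj X X)) (sndHom W (prodObj X X) ≫ sndHom X X) =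
      prodMap (𝟙 W) (addHom X) := by
  refine prod_hom_ext ?_ ?_ <;> simp [addHom_def]

variable {W X} {a p d : ℕ}

/-- `((1_W × s_X) ≫ p₁₂)^* = p₁₂^*` on classes. [cite: Lange2023AbelianVarietiesComplex, §6.3.4 (p0319 L28–L36)] -/
theorem integralHodgeClassesPullbackHom_prodMap_id_liftHom_fst_add_pullbackHom_proj₁₂ (α : integralHodgeClasses (prodObj W X).toIsog.Φ a) :
    integralHodgeClassesPullbackHom (prodMap (𝟙 W) (liftHom (fstHom X X) (fstHom X X + sndHom X X))) a
      (integralHodgeClassesPullbackHom (liftHom (fstHom W (prodObj X X)) (sndHom W (prodObj X X) ≫ fstHom X X)) a α) =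
      integralHodgeClassesPullbackHom (liftHom (fstHom W (prodObj X X)) (sndHom W (prodObj X X) ≫ fstHom X X)) a α := by
  rw [← integralHodgeClassesPullbackHom_comp, prodMap_id_liftHom_fst_add_comp_proj₁₂]

/-- `p₂₃^* pr₂^* = p₁₃^* p₂^*` on `W × (X × X)` (both are the pull-back along the last projection). [cite: Lange2023AbelianVarietiesComplex, §6.3.4 (p0319 L28–L36)] -/
theorem integralHodgeClassesPullbackHom_sndHom_pullbackHom_sndHom (c : integralHodgeClasses X.toIsog.Φ d) :
    integralHodgeClassesPullbackHom (sndHom W (prodObj X X)) d (integralHodgeClassesPullbackHom (sndHom X X) d c) =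
      integralHodgeClassesPullbackHom (liftHom (fstHom W (prodObj X X)) (sndHom W (prodObj X X) ≫ sndHom X X)) d
  (integralHodgeClassesPullbackHom (sndHom W X) d c) := by
  rw [← integralHodgeClassesPullbackHom_comp, ← integralHodgeClassesPullbackHom_comp, liftHom_sndHom]

/-- `p₁₂^* p₂^* = p₂₃^* pr₁^*` on `W × (X × X)` (both are the pull-back along the middle projection). [cite: Lange2023AbelianVarietiesComplex, §6.3.4 (p0319 L28–L36)] -/
theorem integralHodgeClassesPullbackHom_proj₁₂_pullbackHom_sndHom (c' : integralHodgeClasses X.toIsog.Φ p) :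
    integralHodgeClassesPullbackHom (liftHom (fstHom W (prodObj X X)) (sndHom W (prodObj X X) ≫ fstHom X X)) p
  (integralHodgeClassesPullbackHom (sndHom W X) p c') =
      integralHodgeClassesPullbackHom (sndHom W (prodObj X X)) p (integralHodgeClassesPullbackHom (fstHom X X) p c') := by
  rw [← integralHodgeClassesPullbackHom_comp, ← integralHodgeClassesPullbackHom_comp, liftHom_sndHom]

end Plumbing

/-! ## §1 The Pontryagin correspondence `Π_c = (s_X)_*(p₂^*c) = [Δ_X] ⋆_X (X × c)` -/

section PontryaginCorrespondence

variable (X : ComplexTorusCat) {gX gXX gT₀ : ℕ} (eX : Fin (2 * gX) ≃ X.toIsog.ι) (eXX : Fin (2 * gXX) ≃ (prodObj X X).toIsog.ι)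
  (eT₀ : Fin (2 * gT₀) ≃ (prodObj X (prodObj X X)).toIsog.ι) (hX0 : 2 * gX + 2 * 0 = 2 * gX) (hgX : gX + gX = 2 * gX) (hcX : 2 * gX + 2 * gX = 2 * gXX)
  (hgXX : gXX + gXX = 2 * gXX) (hgT₀ : gT₀ + gT₀ = 2 * gT₀) (hgg₀ : gX + gXX = gT₀) (hXX0 : 2 * gXX + 2 * 0 = 2 * gXX) (hlr₀ : 2 * gXX + 2 * gX = 2 * gT₀)
  {d K L : ℕ} (hK : gX + d = K) (hK' : d + gX = K) (hL : L + 2 * K = 2 * gT₀) (hq : L + 2 * d = 2 * gXX)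

include hgg₀ hXX0 hlr₀ in
/-- **`[Δ_X] ⋆_X (X × c) = Π_c := (s_X)_*(p₂^*c)`** for `c ∈ Hdgᵈ(X, ℤ)`: the relative Pontryagin product (over the first factor) of the diagonal with the constant family
`X × c = p₂^*c` is the push-forward of `p₂^*c` along the shear `s_X = (pr₁, pr₁ + pr₂)` — the class of `{(x, x + y)}` weighted by `c(y)` — by the shear formula
`[Γ_f] ⋆_X β = (s_f)_*β` (g31-#5) at `f = 1_X`, `Γ_{1_X} = Δ_X`. This is Künnemann–Moonen's `[Γ_id] ⋆_{pr₁} pr₂^*(λ)`, the correspondence of the operator `Λ` ("on Chow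
groups, `Λ_β` is the `∗`-product with the class `λ(β)`"). [cite: Lange2023AbelianVarietiesComplex, §6.3.4 (p0319 L28–L41) and Lemma 6.3.13 (proof, p0320 L13–L17)]
[cite: Moonen2011ChowMotiveAbelianSchemes, §5 (arXiv p0014 L47–L78; p0017 L37–L40)] -/
theorem integralHodgeClassesRelPontryagin_diagonalClass_pullbackHom_sndHom (c : integralHodgeClasses X.toIsog.Φ d) :
    integralHodgeClassesRelPontryagin eXX eT₀ hgXX hgT₀ hK hL hq
      (integralHodgeClassesPushforward 0 gX (diagHom X) eX eXX hX0 hgX hcX hgXX (unitIntegralHodgeClass X))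
      (integralHodgeClassesPullbackHom (sndHom X X) d c) =
      integralHodgeClassesPushforward d d (liftHom (fstHom X X) (fstHom X X + sndHom X X)) eXX eXX hq hgXX hq hgXX
        (integralHodgeClassesPullbackHom (sndHom X X) d c) := by
  rw [← graphHom_id, integralHodgeClassesRelPontryagin_graphClass_left hgg₀ (𝟙 X) eX eX eXX eT₀ hX0 hgX hcX hgXX hXX0 hlr₀ hgT₀ hK hL hq, Category.comp_id]

include hgg₀ hXX0 hlr₀ hK in
/-- **`(X × c) ⋆_X [Δ_X] = Π_c`** as well (`⋆_X` is commutative, g31-#5). [cite: Lange2023AbelianVarietiesComplex, §6.3.4 (p0319 L36–L41)] -/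
theorem integralHodgeClassesRelPontryagin_pullbackHom_sndHom_diagonalClass (c : integralHodgeClasses X.toIsog.Φ d) :
    integralHodgeClassesRelPontryagin eXX eT₀ hgXX hgT₀ hK' hL hq
      (integralHodgeClassesPullbackHom (sndHom X X) d c)
      (integralHodgeClassesPushforward 0 gX (diagHom X) eX eXX hX0 hgX hcX hgXX (unitIntegralHodgeClass X)) =
      integralHodgeClassesPushforward d d (liftHom (fstHom X X) (fstHom X X + sndHom X X)) eXX eXX hq hgXX hq hgXX
        (integralHodgeClassesPullbackHom (sndHom X X) d c) := by
  rw [← integralHodgeClassesRelPontryagin_comm eXX eT₀ hgXX hgT₀ hK hL hq hK',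
    integralHodgeClassesRelPontryagin_diagonalClass_pullbackHom_sndHom X eX eXX eT₀ hX0 hgX hcX hgXX hgT₀ hgg₀ hXX0 hlr₀ hK hL hq]

/-! ## §2 `(Π_c)_*(x) = x ⋆ c` -/

/-- **`(Π_c)_*(x) = x ⋆ c` for all `x ∈ Hdgᵖ(X, ℤ)`, `c ∈ Hdgᵈ(X, ℤ)`: THE CORRESPONDENCE `Π_c = (s_X)_*(p₂^*c)` INDUCES THE PONTRYAGIN PRODUCT WITH `c`** —
`p_{2*}(Π_c · p₁^*x) = μ_*(p₁^*x · p₂^*c) = x ⋆ c` (Fulton's `α_*(x) = p_{Y*}(α · p_X^*x)`; the projection formula `(s_*z) · w = s_*(z · s^*w)` for the shear, `s ≫ pr₁ =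
pr₁`, `s ≫ pr₂ = μ`; Beauville's "`x ∗ y = m_*(r^*x · s^*y)`", g31-#4 `integralHodgeClassesPontryagin`). [cite: Lange2023AbelianVarietiesComplex, §6.2.3 (p0308 L3–L7)]
[cite: Fulton1998, §16.1 Def. 16.1.2 (p0295 L9–L13) and Prop. 8.3 (c) (p0132 L46–L48)] [cite: Beauville1983FourierChow, §2 (p. 243)]
[cite: Moonen2011ChowMotiveAbelianSchemes, §5 (arXiv p0014 L78: "`Λ_β` is the `∗`-product with the class `λ(β)`")] -/
theorem integralHodgeClassesPushforward_sndHom_pontryaginCorrespondence_cup_pullbackHom_fstHom {p s t m : ℕ} (hs : d + p = s) (hps : p + d = s)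
    (hm : m + 2 * s = 2 * gXX) (hm' : m + 2 * t = 2 * gX) (c : integralHodgeClasses X.toIsog.Φ d) (x : integralHodgeClasses X.toIsog.Φ p) :
    integralHodgeClassesPushforward s t (sndHom X X) eXX eX hm hgXX hm' hgX
      (integralHodgeClassesCup (prodObj X X).toIsog.Φ hs
        (integralHodgeClassesPushforward d d (liftHom (fstHom X X) (fstHom X X + sndHom X X)) eXX eXX hq hgXX hq hgXX
          (integralHodgeClassesPullbackHom (sndHom X X) d c))
        (integralHodgeClassesPullbackHom (fstHom X X) p x)) =
      integralHodgeClassesPontryagin X eX eXX hgX hgXX hps hm hm' x c := by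
  rw [← integralHodgeClassesPushforward_cup_pullbackHom (liftHom (fstHom X X) (fstHom X X + sndHom X X)) eXX eXX hgXX hgXX hs hs hq hq hm hm, ← integralHodgeClassesPushforward_comp,
    ← integralHodgeClassesPullbackHom_comp, liftHom_fstHom, liftHom_fst_add_comp_sndHom, integralHodgeClassesPontryagin_apply',
    integralHodgeClassesCup_comm _ hps hs]

end PontryaginCorrespondence

/-! ## §3 `Π_c ∘ α = α ⋆_W (W × c)` for every correspondence `α : W ⊢ X` -/

section Composition

variable {W X : ComplexTorusCat} {gW gX gXX gWX gT : ℕ} (eW : Fin (2 * gW) ≃ W.toIsog.ι) (eX : Fin (2 * gX) ≃ X.toIsog.ι) (eXX : Fin (2 * gXX) ≃ (prodObj X X).toIsog.ι)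
  (eWX : Fin (2 * gWX) ≃ (prodObj W X).toIsog.ι) (eT : Fin (2 * gT) ≃ (prodObj W (prodObj X X)).toIsog.ι) (hgX : gX + gX = 2 * gX) (hgXX : gXX + gXX = 2 * gXX)
  (hgWX : gWX + gWX = 2 * gWX) (hgT : gT + gT = 2 * gT) (hN : 2 * gW + 2 * gXX = 2 * gT) (hN' : 2 * gW + 2 * gX = 2 * gWX)
  {a d K e L l₃ : ℕ} (hK : a + d = K) (h3 : l₃ + 2 * K = 2 * gT) (h3' : l₃ + 2 * e = 2 * gWX) (hq : L + 2 * d = 2 * gXX)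

include eW hN in
/-- **`Π_c ∘ α = α ⋆_W (W × c)` for every `α ∈ Hdgᵃ(W × X, ℤ)` and `c ∈ Hdgᵈ(X, ℤ)`** — `p₁₃_*(p₁₂^*α · p₂₃^*Π_c) = (1_W × μ_X)_*(p₁₂^*α · p₁₃^*(p₂^*c))` on `W × (X × X)`:
POST-COMPOSING WITH THE PONTRYAGIN CORRESPONDENCE IS THE RELATIVE PONTRYAGIN PRODUCT, OVER THE SOURCE `W`, WITH THE CONSTANT FAMILY `W × c` (g31-#5
`integralHodgeClassesRelPontryagin`). The `⋆`-analogue of `Δ_*(v) ∘ α = α · p₂^*v` (g33-#3 §3), and the identity behind Künnemann's "`[Λ_β, L_γ]` is given by the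
class `pr₂^*(λ) ⋆_{pr₁} ([Γ_id] · pr₂^*(ℓ)) − pr₂^*(ℓ) · ([Γ_id] ⋆_{pr₁} pr₂^*(λ))`" (Moonen, after Künnemann's Lemmas 1.1 (1), 3.1 (1)). Proof: flat base change
`p₂₃^*(s_*z) = (1_W × s)_*(p₂₃^*z)` (g27-#8), the projection formula for `1_W × s` (g27-#2), and `(1 × s) ≫ p₁₂ = p₁₂`, `(1 × s) ≫ p₁₃ = 1 × μ`, `p₂₃^* p₂^* = p₁₃^* p₂^*` (§0).
[cite: Moonen2011ChowMotiveAbelianSchemes, §5 proof (arXiv p0017 L37–L40)] [cite: Fulton1998, §16.1 Prop. 16.1.1 (c)(i) with proof (p0293 L24; p0294 L21–L28) and §1.7 Prop. 1.7 (p0030)]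
[cite: Lange2023AbelianVarietiesComplex, §6.3.4 (p0319 L28–L41) and §6.2.1 Thm. 6.2.4, Thm. 6.2.5 (p0302)] -/
theorem integralHodgeClassesCorrComp_pontryaginCorrespondence_right (α : integralHodgeClasses (prodObj W X).toIsog.Φ a) (c : integralHodgeClasses X.toIsog.Φ d) :
    integralHodgeClassesPushforward K e (liftHom (fstHom W (prodObj X X)) (sndHom W (prodObj X X) ≫ sndHom X X)) eT eWX h3 hgT h3' hgWX
      (integralHodgeClassesCup (prodObj W (prodObj X X)).toIsog.Φ hK
        (integralHodgeClassesPullbackHom (liftHom (fstHom W (prodObj X X)) (sndHom W (prodObj X X) ≫ fstHom X X)) a α)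
        (integralHodgeClassesPullbackHom (sndHom W (prodObj X X)) d
          (integralHodgeClassesPushforward d d (liftHom (fstHom X X) (fstHom X X + sndHom X X)) eXX eXX hq hgXX hq hgXX
            (integralHodgeClassesPullbackHom (sndHom X X) d c)))) =
      integralHodgeClassesRelPontryagin eWX eT hgWX hgT hK h3 h3'
        α
        (integralHodgeClassesPullbackHom (sndHom W X) d c) := by
  rw [← integralHodgeClassesPushforward_id_prodMap_pullbackHom_sndHom' (liftHom (fstHom X X) (fstHom X X + sndHom X X)) W eXX eXX hq hgXX hq hgXX eW eT eT hN hN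
      (show (2 * gW + L) + 2 * d = 2 * gT by omega) hgT (show (2 * gW + L) + 2 * d = 2 * gT by omega) hgT,
    ← integralHodgeClassesPushforward_pullbackHom_cup (prodMap (𝟙 W) (liftHom (fstHom X X) (fstHom X X + sndHom X X))) eT eT hgT hgT (show (2 * gW + L) + 2 * d = 2 * gT by omega)
      (show (2 * gW + L) + 2 * d = 2 * gT by omega) h3 h3 hK hK,
    ← integralHodgeClassesPushforward_comp, prodMap_id_liftHom_fst_add_comp_proj₁₃, integralHodgeClassesPullbackHom_prodMap_id_liftHom_fst_add_pullbackHom_proj₁₂,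
    integralHodgeClassesPullbackHom_sndHom_pullbackHom_sndHom, integralHodgeClassesRelPontryagin_apply]

/-! ## §4 Constant families: `(W × c′) ⋆_W (W × c) = W × (c′ ⋆ c)` -/

variable {p r r' L' l₁ : ℕ} (hpd : p + d = r) (hL : L' + 2 * r = 2 * gT) (hL' : L' + 2 * r' = 2 * gWX) (hl₁ : l₁ + 2 * r = 2 * gXX) (hl₁' : l₁ + 2 * r' = 2 * gX)

include eW hN hN' in
/-- **`(W × c′) ⋆_W (W × c) = W × (c′ ⋆ c)`** for `c′ ∈ Hdgᵖ(X, ℤ)`, `c ∈ Hdgᵈ(X, ℤ)`: on CONSTANT families the relative Pontryagin product over `W` is the absolute Pontryagin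
product `c′ ⋆ c = μ_*(c′ ⊠ c)` of `X` (g31-#4) pulled back along `p₂` ("As in the absolute case …": `p₁₂^*p₂^* = p₂₃^*pr₁^*`, `p₁₃^*p₂^* = p₂₃^*pr₂^*`, and the flat base change
`(1_W × μ)_*(p₂₃^*z) = p₂^*(μ_*z)`, g27-#8). With §3: `Π_c ∘ (Π_{c′} ∘ α) = (α ⋆_W (W × c′)) ⋆_W (W × c)`, two Pontryagin correspondences compose through `c′ ⋆ c`.
[cite: Lange2023AbelianVarietiesComplex, §6.3.4 (p0319 L36–L41) and §6.2.3 (p0308 L3–L7)] [cite: Fulton1998, §1.7 Prop. 1.7 (p0030)] -/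
theorem integralHodgeClassesRelPontryagin_pullbackHom_sndHom_pullbackHom_sndHom (c' : integralHodgeClasses X.toIsog.Φ p) (c : integralHodgeClasses X.toIsog.Φ d) :
    integralHodgeClassesRelPontryagin eWX eT hgWX hgT hpd hL hL'
      (integralHodgeClassesPullbackHom (sndHom W X) p c')
      (integralHodgeClassesPullbackHom (sndHom W X) d c) =
      integralHodgeClassesPullbackHom (sndHom W X) r' (integralHodgeClassesPontryagin X eX eXX hgX hgXX hpd hl₁ hl₁' c' c) := by
  obtain rfl : L' = 2 * gW + l₁ := by omega
  rw [integralHodgeClassesRelPontryagin_apply, integralHodgeClassesPullbackHom_proj₁₂_pullbackHom_sndHom,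
    ← integralHodgeClassesPullbackHom_sndHom_pullbackHom_sndHom, ← integralHodgeClassesPullbackHom_cup,
    integralHodgeClassesPushforward_id_prodMap_pullbackHom_sndHom' (addHom X) W eXX eX hl₁ hgXX hl₁' hgX eW eT eWX hN hN' hL hgT hL' hgWX,
    integralHodgeClassesPontryagin_apply']

end Composition

/-! ## §5 The commutator `[Π_y, Δ_*(u)]` in Künnemann's form -/

section Commutator

variable (X : ComplexTorusCat) {gX gXX gT : ℕ} (eX : Fin (2 * gX) ≃ X.toIsog.ι) (eXX : Fin (2 * gXX) ≃ (prodObj X X).toIsog.ι)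
  (eT : Fin (2 * gT) ≃ (prodObj X (prodObj X X)).toIsog.ι) (hX0 : 2 * gX + 2 * 0 = 2 * gX) (hgX : gX + gX = 2 * gX) (hcX : 2 * gX + 2 * gX = 2 * gXX)
  (hgXX : gXX + gXX = 2 * gXX) (hgT : gT + gT = 2 * gT) (hN : 2 * gX + 2 * gXX = 2 * gT) (hgg₀ : gX + gXX = gT) (hXX0 : 2 * gXX + 2 * 0 = 2 * gXX)
  (hlr₀ : 2 * gXX + 2 * gX = 2 * gT)
  {c c₁ d K₁ K₂ KΔ m₁ l l₃ l₃' L : ℕ} (hc₁ : gX + c = c₁) (hl : l + 2 * c = 2 * gX) (hl' : l + 2 * c₁ = 2 * gXX) (hq : L + 2 * d = 2 * gXX)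
  (hK₁ : c₁ + d = K₁) (h3₁ : l₃ + 2 * K₁ = 2 * gT) (h3₁' : l₃ + 2 * m₁ = 2 * gXX) (hdc : d + c = m₁) (hK₂ : d + c₁ = K₂) (h3₂ : l₃' + 2 * K₂ = 2 * gT)
  (h3₂' : l₃' + 2 * m₁ = 2 * gXX) (hKΔ : gX + d = KΔ) (hLΔ : L + 2 * KΔ = 2 * gT)

include hN hgg₀ hXX0 hlr₀ in
/-- **`Π_y ∘ Δ_*(u) − Δ_*(u) ∘ Π_y = ([Δ]·p₂^*u) ⋆_X (X × y) − ([Δ] ⋆_X (X × y)) · p₂^*u` for `u ∈ Hdgᶜ(X, ℤ)`, `y ∈ Hdgᵈ(X, ℤ)`** — the commutator of the Pontryagin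
correspondence `Π_y = (s_X)_*(p₂^*y)` with the multiplication correspondence `Δ_*(u)` (g33-#3), both composites on `X × (X × X)`, IN KÜNNEMANN'S FORM: Moonen's "By
[KunLef], Lemmas 1.1 (1) and 3.1 (1), the commutator `[Λ_β, L_γ]` is given by the class `pr₂^*(λ(β)) ⋆_{pr₁} ([Γ_id] · pr₂^*(ℓ(γ))) − pr₂^*(ℓ(γ)) · ([Γ_id] ⋆_{pr₁}
pr₂^*(λ(β)))`" (here with the factors of `⋆_X` and of `·` in the other order — both products are commutative, g31-#5 `integralHodgeClassesRelPontryagin_comm`, g27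
`integralHodgeClassesCup_comm`), for `L_γ = Δ_*(ℓ)`, `Λ = Π_λ`, on the integral carriers: §3 (`Π_y ∘ α = α ⋆_X (X × y)`) with `Δ_*(u) = [Δ] · p₂^*u` (g33-#3 §1), and
`Δ_*(u) ∘ α = α · p₂^*u` (g33-#3 §3) with `Π_y = [Δ] ⋆_X (X × y)` (§1). (Künnemann's Lemma 3.2 and Thm. 2.3 then evaluate this class to `Σ (g − i) π_i` for a
polarization; not done here.) [cite: Moonen2011ChowMotiveAbelianSchemes, §5 proof (arXiv p0017 L37–L40) and §5 (arXiv p0015 L2–L8: "[(KunLef)], Thm. 3.3, gives the commutation relation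
`[Λ_{γ⁻¹}, L_γ] = Σ_{i=0}^{2g} (g−i)π_i`")] [cite: Lange2023AbelianVarietiesComplex, §6.3.4 (p0319 L28–L41)] [cite: Fulton1998, §16.1 Example 16.1.14 (ii) (p0302 L14–L20)] -/
theorem integralHodgeClassesCorrComp_pushforward_diagHom_pontryaginCorrespondence_sub (u : integralHodgeClasses X.toIsog.Φ c) (y : integralHodgeClasses X.toIsog.Φ d) :
    integralHodgeClassesPushforward K₁ m₁ (liftHom (fstHom X (prodObj X X)) (sndHom X (prodObj X X) ≫ sndHom X X)) eT eXX h3₁ hgT h3₁' hgXX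
      (integralHodgeClassesCup (prodObj X (prodObj X X)).toIsog.Φ hK₁
        (integralHodgeClassesPullbackHom (liftHom (fstHom X (prodObj X X)) (sndHom X (prodObj X X) ≫ fstHom X X)) c₁
          (integralHodgeClassesPushforward c c₁ (diagHom X) eX eXX hl hgX hl' hgXX u))
        (integralHodgeClassesPullbackHom (sndHom X (prodObj X X)) d
          (integralHodgeClassesPushforward d d (liftHom (fstHom X X) (fstHom X X + sndHom X X)) eXX eXX hq hgXX hq hgXX
            (integralHodgeClassesPullbackHom (sndHom X X) d y)))) -
      integralHodgeClassesPushforward K₂ m₁ (liftHom (fstHom X (prodObj X X)) (sndHom X (prodObj X X) ≫ sndHom X X)) eT eXX h3₂ hgT h3₂' hgXX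
        (integralHodgeClassesCup (prodObj X (prodObj X X)).toIsog.Φ hK₂
          (integralHodgeClassesPullbackHom (liftHom (fstHom X (prodObj X X)) (sndHom X (prodObj X X) ≫ fstHom X X)) d
            (integralHodgeClassesPushforward d d (liftHom (fstHom X X) (fstHom X X + sndHom X X)) eXX eXX hq hgXX hq hgXX
              (integralHodgeClassesPullbackHom (sndHom X X) d y)))
          (integralHodgeClassesPullbackHom (sndHom X (prodObj X X)) c₁ (integralHodgeClassesPushforward c c₁ (diagHom X) eX eXX hl hgX hl' hgXX u))) =
      integralHodgeClassesRelPontryagin eXX eT hgXX hgT hK₁ h3₁ h3₁'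
        (integralHodgeClassesCup (prodObj X X).toIsog.Φ hc₁
          (integralHodgeClassesPushforward 0 gX (diagHom X) eX eXX hX0 hgX hcX hgXX (unitIntegralHodgeClass X))
          (integralHodgeClassesPullbackHom (sndHom X X) c u))
        (integralHodgeClassesPullbackHom (sndHom X X) d y) -
        integralHodgeClassesCup (prodObj X X).toIsog.Φ hdc
          (integralHodgeClassesRelPontryagin eXX eT hgXX hgT hKΔ hLΔ hq
            (integralHodgeClassesPushforward 0 gX (diagHom X) eX eXX hX0 hgX hcX hgXX (unitIntegralHodgeClass X))
            (integralHodgeClassesPullbackHom (sndHom X X) d y))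
          (integralHodgeClassesPullbackHom (sndHom X X) c u) := by
  rw [integralHodgeClassesCorrComp_pushforward_diagHom_right eX eX eXX eXX eT hcX hN hgX hgXX hgXX hgT hdc hK₂ hl hl' h3₂ h3₂'
      (integralHodgeClassesPushforward d d (liftHom (fstHom X X) (fstHom X X + sndHom X X)) eXX eXX hq hgXX hq hgXX
        (integralHodgeClassesPullbackHom (sndHom X X) d y)) u,
    integralHodgeClassesCorrComp_pontryaginCorrespondence_right eX eXX eXX eT hgXX hgXX hgT hN hK₁ h3₁ h3₁' hq
      (integralHodgeClassesPushforward c c₁ (diagHom X) eX eXX hl hgX hl' hgXX u) y,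
    integralHodgeClassesPushforward_diagHom_eq_diagonalClass_cup_pullbackHom_sndHom X eX eXX hX0 hgX hcX hgXX hc₁ hl hl' u,
    ← integralHodgeClassesRelPontryagin_diagonalClass_pullbackHom_sndHom X eX eXX eT hX0 hgX hcX hgXX hgT hgg₀ hXX0 hlr₀ hKΔ hLΔ hq y]

end Commutator

end ComplexTorusCat

end Literature.AlgebraicGeometry.HodgeTheory
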